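import Summits.QuantumAdvantage.QuantumAdvantage.Theorems.FlatDialLCert
import Summits.QuantumAdvantage.QuantumAdvantage.Theorems.GapDialFeedback

/-!
# FlatDialFrame — module 11 of the lens-3 g11 «FlatDial» THEOREMS package (cell decomp-qadv): THE CONCRETE FRAME `A_w` and the `MOD₃` extractor

Record §12 (a), (d), (e) — the pieces (i′) and (iv′) of the `M`-recovery family, kernel-proved.  For a seed `w ∈ {0,1}^m` let `N_w` be
the counter matrix of `HintDial.Automaton` (in coordinates: `nmv w = mv (QQ w)`, all entries literals of `w`) and `a₀ = (0,0)`,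
`b₀ = (m,0)` its origin / terminal coordinates.  THE FRAME `A_w = frameA w` is the additive bijection of `𝔽₂^{k+k}` (`k = 3(m+1)`)
`(y₁, y₂) ↦ (y₁[a₀ ≔ (N_w y₂)_{a₀}], (N_w y₂)[a₀ ≔ y₁(a₀)])` — `I ⊕ N_w` followed by ONE coordinate swap between the halves.  Hence

* `frame_z_iff` : the planted `M`-subspace `L_w = A_w⁻¹{z = 0}` is `{(y₁,y₂) : y₁(a₀) = 0, y₂ ∈ {0, z_w}}` with `z_w = N_w⁻¹ e_{a₀}`
  THE RUN OF THE COUNTER (`HintDial.Automaton.zv`), whose bit at `b₀` is `MOD₃(w)` (`zv_b₀`, = `G0_const`);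
* ★★ `extractB_eq` : for EVERY valid `M`-certificate `c` of the planted function `y ↦ cubeMM (m+1) (A_w y)` (modules 8–10), the
  depth-1 extractor `extractB c = ⋁ₖ rowₖ(c)[b₀″]` equals `MOD₃(w)` — by module 9 (`mem_span_iff_frame`: the rows span exactly `L_w`).

With modules 6–10 this leaves, for the `MRecovery` instance of module 5 (`no_mfinder_of_mRecovery`), only the TABLE level (ii): presenting
`cubeMM (m+1) ∘ A_w` as a `gform` with literal entries (`frameA_x` / `frameA_z` below give the rows) and its signed-cubic duality.
ZERO `def X : Prop`.  Provenance: HOME/decomp-qadv-lens-3/g11/ (record NODE-g11.md §12, LAND-g11.md step 11).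
-/

set_option linter.dupNamespace false

namespace Summit.QuantumAdvantage.QuantumAdvantage.Theorems.FlatDial

open Finset
open Literature.Computability.Complexity
open Literature.Computability.QuantumComplexity
open Literature.Computability.MetaComplexity
open Literature.Computability.QuantumComplexity.BuzetChailloux (bxor zeroVec bxor_self bxor_zeroVec zeroVec_bxor)
open Summit.QuantumAdvantage.QuantumAdvantage.Theorems.HintDial.Automaton (bd sgl bd_sgl_left bd_sgl_right kk nd Nd NV nmul nsolve
  toNV ofNV a₀ b₀ QQ zv rEnt single mv mv_QQ nmul_nsolve nsolve_nmul toNV_ofNV ofNV_toNV G0_const mv_bxor bd_zeroVec_right)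

section Frame

variable {m : ℕ} (w : Fin m → Bool)

/-! ## 1. `N_w` and `N_w⁻¹` in coordinates -/

/-- `N_w · x` in coordinates. -/
def nmv (x : Fin (kk m) → Bool) : Fin (kk m) → Bool := ofNV (nmul w (toNV x))

/-- `N_w⁻¹ · x` in coordinates. -/
def nsv (x : Fin (kk m) → Bool) : Fin (kk m) → Bool := ofNV (nsolve w (toNV x))

/-- `N_w⁻¹ N_w = 1`. -/
theorem nsv_nmv (x : Fin (kk m) → Bool) : nsv w (nmv w x) = x := by
  rw [nsv, nmv, toNV_ofNV, nsolve_nmul, ofNV_toNV]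

/-- `N_w N_w⁻¹ = 1`. -/
theorem nmv_nsv (x : Fin (kk m) → Bool) : nmv w (nsv w x) = x := by
  rw [nsv, nmv, toNV_ofNV, nmul_nsolve, ofNV_toNV]

/-- `N_w` is the matrix `QQ w` (entries literals of `w`). -/
theorem nmv_eq_mv (x : Fin (kk m) → Bool) : nmv w x = mv (QQ w) x := (mv_QQ w x).symm

/-- `N_w` is additive. -/
theorem nmv_bxor (x y : Fin (kk m) → Bool) : nmv w (bxor x y) = bxor (nmv w x) (nmv w y) := by
  rw [nmv_eq_mv, nmv_eq_mv, nmv_eq_mv, mv_bxor]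

/-- `N_w 0 = 0`. -/
theorem nmv_zeroVec : nmv w (zeroVec : Fin (kk m) → Bool) = zeroVec :=
  funext fun a => by rw [nmv_eq_mv]; exact bd_zeroVec_right _

/-- `N_w⁻¹ 0 = 0`. -/
theorem nsv_zeroVec : nsv w (zeroVec : Fin (kk m) → Bool) = zeroVec := by
  have h := nsv_nmv w zeroVec
  rwa [nmv_zeroVec] at h

/-- `N_w⁻¹ e_{a₀}` is THE RUN `z_w`. -/
theorem nsv_sgl_a₀ : nsv w (sgl a₀) = zv w := by
  funext b
  show ofNV (nsolve w (toNV (sgl a₀))) b = ofNV (nsolve w (single (nd.symm a₀))) b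
  rw [Summit.QuantumAdvantage.QuantumAdvantage.Theorems.GapDial.Automaton.toNV_sgl_a₀, a₀, Equiv.symm_apply_apply]

/-- `N_w z_w = e_{a₀}`. -/
theorem nmv_zv : nmv w (zv w) = sgl a₀ := by
  rw [← nsv_sgl_a₀, nmv_nsv]

/-- ★ the run's bit at the terminal node is `MOD₃(w)` (`HintDial.Automaton.G0_const`). -/
theorem zv_b₀ : zv w b₀ = decide (GateFn.numOnes w % 3 = 0) := G0_const w

/-- `N_w y₂` vanishes off `a₀` iff `y₂ ∈ {0, z_w}`. -/
theorem nmv_off_a₀_iff (y₂ : Fin (kk m) → Bool) : (∀ b, b ≠ a₀ → nmv w y₂ b = false) ↔ (y₂ = zeroVec ∨ y₂ = zv w) := by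
  constructor
  · intro h
    cases hv : nmv w y₂ a₀
    · left
      have e : nmv w y₂ = zeroVec := funext fun b => by
        by_cases hb : b = a₀
        · subst hb; exact hv
        · exact h b hb
      rw [← nsv_nmv w y₂, e, nsv_zeroVec]
    · right
      have e : nmv w y₂ = sgl a₀ := funext fun b => by
        by_cases hb : b = a₀
        · subst hb; rw [hv]; exact (decide_eq_true rfl).symm
        · rw [h b hb]; exact (decide_eq_false hb).symm
      rw [← nsv_nmv w y₂, e, nsv_sgl_a₀]
  · rintro (rfl | rfl) b hb
    · rw [nmv_zeroVec]; rfl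
    · rw [nmv_zv]; exact decide_eq_false hb

/-! ## 2. The frame `A_w` -/

/-- `A_w` as a function: `I ⊕ N_w`, then swap coordinate `a₀` between the halves. -/
def frameFun (y : Fin (kk m + kk m) → Bool) : Fin (kk m + kk m) → Bool :=
  Fin.append (fun a => if a = a₀ then nmv w (fun b => y (Fin.natAdd (kk m) b)) a₀ else y (Fin.castAdd (kk m) a))
    fun b => if b = a₀ then y (Fin.castAdd (kk m) a₀) else nmv w (fun b => y (Fin.natAdd (kk m) b)) b

/-- `A_w⁻¹` as a function. -/
def frameInv (y : Fin (kk m + kk m) → Bool) : Fin (kk m + kk m) → Bool :=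
  Fin.append (fun a => if a = a₀ then y (Fin.natAdd (kk m) a₀) else y (Fin.castAdd (kk m) a))
    (nsv w fun b => if b = a₀ then y (Fin.castAdd (kk m) a₀) else y (Fin.natAdd (kk m) b))

/-- first half of `A_w y`. -/
theorem frameFun_x (y : Fin (kk m + kk m) → Bool) (a : Fin (kk m)) : frameFun w y (Fin.castAdd (kk m) a)
    = if a = a₀ then nmv w (fun b => y (Fin.natAdd (kk m) b)) a₀ else y (Fin.castAdd (kk m) a) := by
  rw [frameFun, Fin.append_left]

/-- second half of `A_w y`. -/
theorem frameFun_z (y : Fin (kk m + kk m) → Bool) (b : Fin (kk m)) : frameFun w y (Fin.natAdd (kk m) b)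
    = if b = a₀ then y (Fin.castAdd (kk m) a₀) else nmv w (fun b => y (Fin.natAdd (kk m) b)) b := by
  rw [frameFun, Fin.append_right]

/-- `A_w⁻¹ A_w = 1`. -/
theorem frameInv_frameFun (y : Fin (kk m + kk m) → Bool) : frameInv w (frameFun w y) = y := by
  have hz : (fun b => if b = a₀ then frameFun w y (Fin.castAdd (kk m) a₀) else frameFun w y (Fin.natAdd (kk m) b))
      = nmv w fun b => y (Fin.natAdd (kk m) b) := by
    funext b
    by_cases hb : b = a₀
    · subst hb; rw [if_pos rfl, frameFun_x, if_pos rfl]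
    · rw [if_neg hb, frameFun_z, if_neg hb]
  funext i
  refine Fin.addCases (fun a => ?_) (fun b => ?_) i
  · rw [frameInv, Fin.append_left]
    by_cases ha : a = a₀
    · subst ha; rw [if_pos rfl, frameFun_z, if_pos rfl]
    · rw [if_neg ha, frameFun_x, if_neg ha]
  · rw [frameInv, Fin.append_right, hz, nsv_nmv]

/-- `A_w A_w⁻¹ = 1`. -/
theorem frameFun_frameInv (y : Fin (kk m + kk m) → Bool) : frameFun w (frameInv w y) = y := by
  have hz : (fun b => frameInv w y (Fin.natAdd (kk m) b))
      = nsv w fun b => if b = a₀ then y (Fin.castAdd (kk m) a₀) else y (Fin.natAdd (kk m) b) := by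
    funext b; rw [frameInv, Fin.append_right]
  funext i
  refine Fin.addCases (fun a => ?_) (fun b => ?_) i
  · rw [frameFun_x, hz, nmv_nsv]
    by_cases ha : a = a₀
    · subst ha; rw [if_pos rfl, if_pos rfl]
    · rw [if_neg ha, frameInv, Fin.append_left, if_neg ha]
  · rw [frameFun_z, hz, nmv_nsv]
    by_cases hb : b = a₀
    · subst hb; rw [if_pos rfl, frameInv, Fin.append_left, if_pos rfl]
    · rw [if_neg hb, if_neg hb]

/-- ★ THE FRAME `A_w`, an additive bijection of `𝔽₂^{k+k}`. -/
def frameA : Equiv.Perm (Fin (kk m + kk m) → Bool) :=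
  ⟨frameFun w, frameInv w, frameInv_frameFun w, frameFun_frameInv w⟩

/-- unfolding. -/
theorem frameA_apply (y : Fin (kk m + kk m) → Bool) : frameA w y = frameFun w y := rfl

/-- first half of `A_w y` (for the table presentation: every row is a coordinate or a row of `QQ w`). -/
theorem frameA_x (y : Fin (kk m + kk m) → Bool) (a : Fin (kk m)) : frameA w y (Fin.castAdd (kk m) a)
    = if a = a₀ then bd (QQ w a₀) (fun b => y (Fin.natAdd (kk m) b)) else y (Fin.castAdd (kk m) a) := by
  rw [frameA_apply, frameFun_x, nmv_eq_mv]; rfl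

/-- second half of `A_w y`. -/
theorem frameA_z (y : Fin (kk m + kk m) → Bool) (b : Fin (kk m)) : frameA w y (Fin.natAdd (kk m) b)
    = if b = a₀ then y (Fin.castAdd (kk m) a₀) else bd (QQ w b) (fun b => y (Fin.natAdd (kk m) b)) := by
  rw [frameA_apply, frameFun_z, nmv_eq_mv]; rfl

/-- ★ `A_w` is additive. -/
theorem frameA_bxor (x y : Fin (kk m + kk m) → Bool) : frameA w (bxor x y) = bxor (frameA w x) (frameA w y) := by
  funext i
  refine Fin.addCases (fun a => ?_) (fun b => ?_) i
  · show frameFun w (bxor x y) (Fin.castAdd (kk m) a) = xor (frameFun w x (Fin.castAdd (kk m) a)) (frameFun w y (Fin.castAdd (kk m) a))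
    rw [frameFun_x, frameFun_x, frameFun_x]
    by_cases ha : a = a₀
    · rw [if_pos ha, if_pos ha, if_pos ha,
        show (fun b => bxor x y (Fin.natAdd (kk m) b)) = bxor (fun b => x (Fin.natAdd (kk m) b)) (fun b => y (Fin.natAdd (kk m) b))
          from rfl, nmv_bxor]
    · rw [if_neg ha, if_neg ha, if_neg ha]
  · show frameFun w (bxor x y) (Fin.natAdd (kk m) b) = xor (frameFun w x (Fin.natAdd (kk m) b)) (frameFun w y (Fin.natAdd (kk m) b))
    rw [frameFun_z, frameFun_z, frameFun_z]
    by_cases hb : b = a₀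
    · rw [if_pos hb, if_pos hb, if_pos hb]
    · rw [if_neg hb, if_neg hb, if_neg hb,
        show (fun b => bxor x y (Fin.natAdd (kk m) b)) = bxor (fun b => x (Fin.natAdd (kk m) b)) (fun b => y (Fin.natAdd (kk m) b))
          from rfl, nmv_bxor]

/-- ★ THE PLANTED `M`-SUBSPACE `L_w = A_w⁻¹{z = 0}` is `{(y₁, y₂) : y₁(a₀) = 0, y₂ ∈ {0, z_w}}`. -/
theorem frame_z_iff (y : Fin (kk m + kk m) → Bool) : (∀ i, frameA w y (Fin.natAdd (kk m) i) = false) ↔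
    y (Fin.castAdd (kk m) a₀) = false ∧
      ((fun b => y (Fin.natAdd (kk m) b)) = zeroVec ∨ (fun b => y (Fin.natAdd (kk m) b)) = zv w) := by
  rw [← nmv_off_a₀_iff]
  simp only [frameA_apply, frameFun_z]
  constructor
  · intro h
    refine ⟨by simpa using h a₀, fun b hb => ?_⟩
    have := h b; rwa [if_neg hb] at this
  · rintro ⟨h0, h⟩ i
    by_cases hi : i = a₀
    · rw [if_pos hi]; exact h0
    · rw [if_neg hi]; exact h i hi

/-- the planted function `y ↦ cubeMM (m+1) (A_w y)` is in `MM#` (module 10). -/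
theorem cubeMM_frameA_mem_hasMSub : (fun y => cubeMM (m + 1) (frameA w y)) ∈ hasMSub (kk m + kk m) :=
  cubeMM_frame_mem_hasMSub (r := m + 1) (A := frameA w) (frameA_bxor w)

/-! ## 3. The extractor and the `MOD₃` leak -/

/-- ★ THE EXTRACTOR (one OR gate): does some certificate row have a `1` at coordinate `b₀` of the second half? -/
def extractB (c : CertIdx (kk m + kk m) → Bool) : Bool :=
  decide (∃ k : Fin ((kk m + kk m) / 2), certRow c k (Fin.natAdd (kk m) b₀) = true)

/-- ★★ `M`-RECOVERY: every valid `M`-certificate of the planted function leaks `MOD₃(w)` through `extractB`. -/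
theorem extractB_eq {c : CertIdx (kk m + kk m) → Bool} (hc : c ∈ validMCerts fun y => cubeMM (m + 1) (frameA w y)) :
    extractB c = decide (GateFn.numOnes w % 3 = 0) := by
  have key : ∀ y, y ∈ span c ↔ ∀ i, frameA w y (Fin.natAdd (kk m) i) = false :=
    fun y => mem_span_iff_frame (r := m + 1) (A := frameA w) (frameA_bxor w) hc y
  by_cases h3 : GateFn.numOnes w % 3 = 0
  · rw [decide_eq_true h3]
    -- `(0, z_w) ∈ L_w` is a row combination, and its bit at `b₀″` is `MOD₃(w) = 1`
    have hy : (Fin.append zeroVec (zv w) : Fin (kk m + kk m) → Bool) ∈ span c := by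
      rw [key, frame_z_iff]
      refine ⟨by rw [Fin.append_left]; rfl, Or.inr (funext fun b => by rw [Fin.append_right])⟩
    obtain ⟨a, -, ha⟩ := mem_image.1 hy
    have hb : bd a (fun k => certRow c k (Fin.natAdd (kk m) b₀)) = true := by
      have := congrFun ha (Fin.natAdd (kk m) b₀)
      rw [Fin.append_right, zv_b₀, decide_eq_true h3] at this
      exact this
    apply decide_eq_true
    by_contra hne
    have hz : (fun k => certRow c k (Fin.natAdd (kk m) b₀)) = zeroVec :=
      funext fun k => by
        cases hk : certRow c k (Fin.natAdd (kk m) b₀)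
        · rfl
        · exact absurd ⟨k, hk⟩ hne
    rw [hz, bd_zeroVec_right] at hb
    exact Bool.false_ne_true hb
  · rw [decide_eq_false h3]
    apply decide_eq_false
    rintro ⟨k, hk⟩
    have hmem := (key _).1 (certRow_mem_span c k)
    rw [frame_z_iff] at hmem
    rcases hmem.2 with h0 | hz
    · have := congrFun h0 b₀
      rw [hk] at this
      exact Bool.noConfusion this
    · have := congrFun hz b₀
      rw [hk, zv_b₀, decide_eq_false h3] at this
      exact Bool.noConfusion this

end Frame

end Summit.QuantumAdvantage.QuantumAdvantage.Theorems.FlatDial
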